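import Summits.QuantumFields.YangMills.Theorems.ColdStartUniversalityLatticeLangevinBakryEmeryUniformGap
import Summits.QuantumFields.YangMills.Theorems.ColdStartUniversalityUniformColdStartMixingRungOfHarris
import Literature.MathematicalPhysics.QuantumFieldTheory.ShenZhuZhuErgodicity
import HarnessLib

/-!
# Route `ColdStartUniversality` (fixed-cut-off package): THE NAMED FACT `shenZhuZhu_L2SpectralGap (fundamentalLatticeRep 2) 3` IS A THEOREM —
# Shen–Zhu–Zhu's Remark 4.6 (volume-uniform `L²` spectral gap of the lattice Langevin dynamics) for `SU(2)` lattice Yang–Mills in `d = 3`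

Helper file (seat `ym-line-csu-p1`, g38; `--supports stmt-QuantumFields-24809`).  `Literature…ShenZhuZhuErgodicity` types Shen–Zhu–Zhu's
Remark 4.6 (CMP 400 (2023) p. 20: `‖P_t^L f − μ_{Λ_L,N,β}(f)‖_{L²(μ)} ≤ e^{−tK_𝒮}‖f‖_{L²(μ)}` under Assumption 1.1, for the transition operators of
ANY family of strong solutions of the SDE (3.3) from all deterministic starts) as the NAMED FACT `shenZhuZhu_L2SpectralGap r d` — a conjunction of an
`SU(N)` clause and an `SO(N)` clause.  For `r = fundamentalLatticeRep 2` (structure group `SU(2)`), `d = 3`: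
* `not_isDefiningSO_fundamentalLatticeRep_two` — the `SO` clause is vacuous (`diag(i, −i) ∈ SU(2)` is not a real matrix);
* ★★★ `shenZhuZhu_L2SpectralGap_su2_d3 : shenZhuZhu_L2SpectralGap (fundamentalLatticeRep 2) 3` — the `SU(2)` clause from the seat's
  volume-uniform `L²` spectral gap `wilson_spectralGap_uniform_measurable` (Bakry–Émery, rate `1 − 12|β'|` at `|β'| < 1/12`, g25) via THE transition
  kernels `exists_transitionKernel` (the transition operator of any strong solution family is `∫ f dκ_t(x)`, uniqueness in law): at tree coupling
  `β' = 2β` Shen–Zhu–Zhu's `K_𝒮 = N/2 − 8(d−1)N|β| = 1 − 32|β| = 1 − 16|β'|` is SMALLER than the tree's rate `1 − 12|β'|`, and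
  `∫(f − μf)² ≤ ∫f²`, so the printed inequality follows for every torus size `L`.
THEOREMS ONLY, no definition, no sorry.  HONEST FRAMING: a STRONG-coupling (`|β| < 1/32` 't Hooft), FIXED-cut-off statement; nothing `K`-uniform
along the route's scaling (`UniformColdStartMixing`, 24809, ASIDE, not restated); no crux, rung or summit statement is proved; the Yang–Mills mass
gap is NOT proved.
-/

set_option autoImplicit false

noncomputable section

namespace Summit.QuantumFields.YangMills.Theorems.ColdStartUniversality

open MeasureTheory ProbabilityTheory Finset Filter Set
open scoped BigOperators NNReal ENNReal Topology
open Literature.Probability.Process Literature.MathematicalPhysics.QuantumFieldTheory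
open Literature.MathematicalPhysics.QuantumLattice (fundamentalRep fundamentalLatticeRep continuous_fundamentalRep fundamentalRep_apply)

/-! ## §1. The `SO` clause is vacuous for `SU(2)` -/

/-- `SU(2)` in its defining representation is not (the complexification of) `SO(2)`: the range of `fundamentalRep (Fin 2)` contains
`diag(i, −i)`, which is not a real matrix. [cite: ShenZhuZhuCMP2023, §1.1] -/
theorem not_isDefiningSO_fundamentalLatticeRep_two : ¬ (fundamentalLatticeRep 2).IsDefiningSO := by
  intro h
  set g : Matrix (Fin 2) (Fin 2) ℂ := !![Complex.I, 0; 0, -Complex.I] with hg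
  have hgU : g ∈ Matrix.unitaryGroup (Fin 2) ℂ := by
    rw [Matrix.mem_unitaryGroup_iff]
    ext i j
    fin_cases i <;> fin_cases j <;> simp [hg, Matrix.mul_apply, Fin.sum_univ_two]
  have hgdet : g.det = 1 := by
    simp [hg, Matrix.det_fin_two]
  have hgSU : g ∈ Matrix.specialUnitaryGroup (Fin 2) ℂ := Matrix.mem_specialUnitaryGroup_iff.2 ⟨hgU, hgdet⟩
  have hmem : g ∈ Set.range (fundamentalLatticeRep 2).ρ := ⟨⟨g, hgSU⟩, rfl⟩
  have h' : Set.range (fundamentalLatticeRep 2).ρ =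
      Complex.ofRealHom.mapMatrix '' (Matrix.specialOrthogonalGroup (Fin 2) ℝ : Set (Matrix (Fin 2) (Fin 2) ℝ)) := h
  rw [h'] at hmem
  obtain ⟨M, -, hM⟩ := hmem
  have h00 := congrArg Complex.im (congrFun (congrFun hM 0) 0)
  simp [hg] at h00

/-! ## §2. The named fact -/

/-- ★★★ **THE NAMED FACT `shenZhuZhu_L2SpectralGap (fundamentalLatticeRep 2) 3` IS A THEOREM: Shen–Zhu–Zhu's Remark 4.6 for `SU(2)`, `d = 3`.**
For every 't Hooft coupling `β` with `K_𝒮 = 1 − 32|β| > 0`, every torus size `L > 1`, every family `(U^x)_x` of strong solutions of the `SU(2)`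
lattice Langevin dynamics at tree coupling `2β` from all deterministic starts (any probability space, any flat driver), every bounded measurable `f`
and every `t ≥ 0`: `∫ (P_t f − μ(f))² dμ ≤ e^(−2K_𝒮 t) ∫ f² dμ`, `P_t f(x) = 𝔼 f(U^x_t)`, `μ` the Wilson measure — from the volume-uniform Bakry–Émery
gap `1 − 12|β'| ≥ K_𝒮` of the route's fixed-cut-off package.  HONEST FRAMING: strong coupling, fixed cut-off; not a mass-gap statement.
[cite: ShenZhuZhuCMP2023, Remark 4.6] -/
theorem shenZhuZhu_L2SpectralGap_su2_d3 : shenZhuZhu_L2SpectralGap (fundamentalLatticeRep 2) 3 := by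
  intro _hd
  refine ⟨?_, fun hSO => absurd hSO not_isDefiningSO_fundamentalLatticeRep_two⟩
  intro _hSU β hK L _ _hL Ω _ P _ W hW U hU f hf hfb t
  classical
  have hN : (((fundamentalLatticeRep 2).N : ℕ) : ℝ) = 2 := by
    rw [Literature.MathematicalPhysics.QuantumLattice.fundamentalLatticeRep_N]; norm_num
  set β' : ℝ := (((fundamentalLatticeRep 2).N : ℕ) : ℝ) * β with hβ'
  set K : ℝ := szzBakryEmeryConstSU (fundamentalLatticeRep 2).N 3 β with hKdef
  have hKeq : K = 1 - 32 * |β| := by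
    rw [hKdef, szzBakryEmeryConstSU_eq, hN]; norm_num; ring
  have hβabs : |β'| = 2 * |β| := by
    rw [hβ', hN, abs_mul, abs_of_pos (by norm_num : (0 : ℝ) < 2)]
  have hβ12 : |β'| < 1 / 12 := by
    rw [hKeq] at hK; rw [hβabs]; linarith
  have hlamK : K ≤ 1 - 12 * |β'| := by
    rw [hKeq, hβabs]; linarith [abs_nonneg β]
  set μ : Measure (GaugeConfig 3 L (Matrix.specialUnitaryGroup (Fin 2) ℂ)) :=
    wilsonMeasure (d := 3) (L := L) (fundamentalRep (Fin 2)) β' with hμ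
  haveI : IsProbabilityMeasure μ :=
    isProbabilityMeasure_wilsonMeasure (d := 3) (L := L) (fundamentalRep (Fin 2)) (continuous_fundamentalRep (Fin 2)) β'
  -- THE transition kernels and the `L²` gap for them
  obtain ⟨κ, hκM, -, hreal⟩ := exists_transitionKernel L β'
  haveI : ∀ s, IsMarkovKernel (κ s) := hκM
  obtain ⟨C, hC⟩ := hfb
  have hgap := wilson_spectralGap_uniform_measurable L β' hβ12 κ hreal hf hC t
  -- the transition operator of the given solution family is `∫ f dκ_t(x)`
  have hmt : ∀ x, markovTransition U P t f x = ∫ y, f y ∂(κ t x) := by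
    intro x
    have hmeas : Measurable (U x t) := ((hU x).2.adapted t).mono (hW.natFiltration.le t) le_rfl
    rw [hreal t x Ω P W hW (U x) (hU x).1 (hU x).2, integral_map hmeas.aemeasurable hf.aestronglyMeasurable]
    rfl
  -- `∫ (f − μf)² ≤ ∫ f²`
  have hmem : MemLp f 2 μ := MemLp.of_bound hf.aestronglyMeasurable C (ae_of_all _ fun y => by
    rw [Real.norm_eq_abs]; exact hC y)
  have hvar_le : ∫ x, (f x - ∫ z, f z ∂μ) ^ 2 ∂μ ≤ ∫ x, f x ^ 2 ∂μ := by
    have h1 : ∫ x, (f x - ∫ z, f z ∂μ) ^ 2 ∂μ = Var[f; μ] := (variance_eq_integral hf.aemeasurable).symm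
    have h2 : Var[f; μ] = (∫ x, (f ^ 2) x ∂μ) - (∫ x, f x ∂μ) ^ 2 := variance_eq_sub hmem
    rw [h1, h2]
    have h3 : (∫ x, (f ^ 2) x ∂μ) = ∫ x, f x ^ 2 ∂μ := rfl
    rw [h3]
    linarith [sq_nonneg (∫ x, f x ∂μ)]
  -- assembly
  show ∫ x, (markovTransition U P t f x - ∫ y, f y ∂μ) ^ 2 ∂μ ≤ Real.exp (-2 * K * t) * ∫ x, f x ^ 2 ∂μ
  simp only [hmt]
  have hexp : Real.exp (-2 * (1 - 12 * |β'|) * t) ≤ Real.exp (-2 * K * t) := by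
    apply Real.exp_le_exp.2
    have ht : (0 : ℝ) ≤ t := NNReal.coe_nonneg t
    nlinarith
  have hsq0 : 0 ≤ ∫ x, f x ^ 2 ∂μ := integral_nonneg fun x => sq_nonneg _
  calc ∫ x, ((∫ y, f y ∂(κ t x)) - ∫ y, f y ∂μ) ^ 2 ∂μ
      ≤ Real.exp (-2 * (1 - 12 * |β'|) * t) * ∫ x, (f x - ∫ z, f z ∂μ) ^ 2 ∂μ := hgap
    _ ≤ Real.exp (-2 * (1 - 12 * |β'|) * t) * ∫ x, f x ^ 2 ∂μ := mul_le_mul_of_nonneg_left hvar_le (Real.exp_nonneg _)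
    _ ≤ Real.exp (-2 * K * t) * ∫ x, f x ^ 2 ∂μ := mul_le_mul_of_nonneg_right hexp hsq0

end Summit.QuantumFields.YangMills.Theorems.ColdStartUniversality
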